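import Literature.AlgebraicGeometry.HodgeTheory.LocallyTrivialExtensionClasses
import Summits.HodgeConjecture.HodgeConjecture.Theorems.LinearSystemTorelliLocalTubeSpanAlgebra
import Summits.HodgeConjecture.HodgeConjecture.Theorems.LinearSystemTorelliLocalTubeSpanDirectSum
import Summits.HodgeConjecture.HodgeConjecture.Theorems.LinearSystemTorelliLocalTubeSpanFiniteIndex

/-!
# Route LinearSystemTorelli — crux `LocalTubeSpan` (stmt-HodgeConjecture-2490): trivial summands and finite index

Composition file (`--supports stmt-HodgeConjecture-2490`, line `Sketch` of the crux chain, cycle 4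
"portability of cyclic detection").  Two more transports of cyclic detection (injectivity of
Schnell's third map `evalCoinv A : H¹(G, A) → ∏_g A/(g - 1)A`) needed to move between the carriers
a typed crux may use:

* `localTubeSpan_injective_evalCoinv_of_isTrivial` — detection is automatic for a TRIVIAL
  representation (`(g - 1)A = 0` forces an undetected cocycle to vanish);
* `localTubeSpan_injective_evalCoinv_iff_of_trivialComplement` — for `A = W₁ ⊕ W₂` with `W₁`
  stable and `G` acting trivially on `W₂`, detection for `A` is equivalent to detection for `W₁`
  (`…DirectSum` + the previous item).  Dictionary: `H^{2p-1}(X_s) = H^{2p-1}(X_s)_van ⊕ i^*H^{2p-1}(X)`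
  with trivial monodromy on the second summand — the two carriers `monodromyBetti` /
  `vanishingMonodromy` of the tree's `HyperplaneSectionLocalSystem`;
* `localTubeSpan_ker_evalCoinvOn_eq_H1resKer_of_finiteIndex` — the line's surrogate of the crux at
  a local group `S` from injectivity of the third map on a finite-index subgroup `H ≤ S` with index
  invertible in `k` (`…FiniteIndex`: restriction to `H` is injective by averaging over cosets) —
  e.g. the pure local braid group inside the local braid group, or the subgroup generated by powers
  of the meridians.

Pure algebra over Mathlib and the tree's `LocallyTrivialExtensionClasses`; no named facts.
-/

-- `Summit.HodgeConjecture.HodgeConjecture.Theorems` is the mandated namespace (single-conjunct summit: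
-- Sub = Summit), which `linter.dupNamespace` flags on every declaration; the lakefile turns the
-- linter off tree-wide (weak option), restated here so stand-alone elaboration is warning-free too.
set_option linter.dupNamespace false

noncomputable section

open CategoryTheory groupCohomology
open Literature.AlgebraicGeometry.HodgeTheory

namespace Summit.HodgeConjecture.HodgeConjecture.Theorems

universe u

variable {k G : Type u} [Group G]

/-- Detection is automatic for a TRIVIAL representation: `(g - 1)A = 0`, so an undetected
cocycle vanishes identically and its class is zero. [folklore] -/
theorem localTubeSpan_injective_evalCoinv_of_isTrivial [CommRing k] (A : Rep k G) [A.ρ.IsTrivial] :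
    Function.Injective (evalCoinv A) := by
  refine (injective_iff_map_eq_zero _).2 fun ξ hξ => ?_
  have h := localTubeSpan_mem_H1resKer_of_evalCoinv_eq_zero A ⊤
    (fun g _ v => Representation.isTrivial_apply A.ρ g v) hξ
  rwa [H1resKer_top, Submodule.mem_bot] at h

/-- **Trivial complement.**  If `A = W₁ ⊕ W₂` with `W₁` `G`-stable and `G` acting trivially on
`W₂` (e.g. the vanishing cohomology next to the invariant part `i^*H^{2p-1}(X)` of
`H^{2p-1}(X_s)`), then Schnell's third map of `A` is injective iff that of the subrepresentation
`W₁` is. [folklore] -/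
theorem localTubeSpan_injective_evalCoinv_iff_of_trivialComplement [CommRing k] (A : Rep k G)
    (W₁ W₂ : Submodule k A.V) (h₁ : ∀ g : G, W₁ ≤ W₁.comap (A.ρ g))
    (h₂ : ∀ (g : G), ∀ w ∈ W₂, A.ρ g w = w) (hc : IsCompl W₁ W₂) :
    Function.Injective (evalCoinv A) ↔
      Function.Injective (evalCoinv (Rep.of (A.ρ.subrepresentation W₁ h₁))) := by
  have h₂' : ∀ g : G, W₂ ≤ W₂.comap (A.ρ g) := fun g w hw => by
    rw [Submodule.mem_comap, h₂ g w hw]; exact hw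
  haveI : (Rep.of (A.ρ.subrepresentation W₂ h₂')).ρ.IsTrivial :=
    ⟨fun g => LinearMap.ext fun w => Subtype.ext (h₂ g w w.2)⟩
  rw [localTubeSpan_injective_evalCoinv_iff_of_isCompl A W₁ W₂ h₁ h₂' hc]
  exact ⟨fun h => h.1, fun h => ⟨h, localTubeSpan_injective_evalCoinv_of_isTrivial _⟩⟩

/-- **The surrogate crux from a finite-index subgroup.**  At a subgroup `S ≤ G` (a local
fundamental group) with a finite-index subgroup `H ≤ S` whose index is invertible in the field
`k`: if Schnell's third map of `A|_H` is injective, then the classes of `H¹(G, A)` undetected by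
every element of `S` are exactly those restricting to zero on `S`
(`ker (evalCoinvOn A S) = H1resKer A S`). [folklore] -/
theorem localTubeSpan_ker_evalCoinvOn_eq_H1resKer_of_finiteIndex [Field k] (A : Rep k G)
    (S : Subgroup G) (H : Subgroup S) [H.FiniteIndex] (hn : (H.index : k) ≠ 0)
    (hinj : Function.Injective (evalCoinv (Rep.res H.subtype (Rep.res S.subtype A)))) :
    LinearMap.ker (evalCoinvOn A S) = H1resKer A S :=
  localTubeSpan_ker_evalCoinvOn_eq_H1resKer_of_injective A S
    (localTubeSpan_injective_evalCoinv_of_finiteIndex (Rep.res S.subtype A) H hn hinj)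

end Summit.HodgeConjecture.HodgeConjecture.Theorems

end
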